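import Summits.BirchSwinnertonDyer.Rank1Residual.X10.UnitRoadBSD
import Summits.BirchSwinnertonDyer.Rank1Residual.X10.UnitRoadPartnerRecordsB
import HarnessLib

/-!
# Class X10b (N2), the TRIVIAL-PARTNER road at `p = 3`: `BSD(E,3)` AT THE PAIR, records part B —
# 4 NON-unit N2 cells (343850cr1, 38870bf1, 72670w1, 107822s1), every one with `9 ∣ ∏ c_ℓ(E)`, from a congruent curve of TRIVIAL
# `3`-primary arithmetic whose Tamagawa binder is now a KERNEL certificate (cell `b2b-bsdres`, unit
# `b2b-bsdres-x10` = N2 class lead, gen 25)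

HONEST FRAMING (run/shared/lean/b2b/bsd-rank1-residual/, verbatim in every file): the goal of the
cell is to DELETE the COMBINATION-SHAPED residual classes of the Birch–Swinnerton-Dyer formula for
ALL analytic-rank `≤ 1` elliptic curves over `ℚ` — "full BSD formula for every rank `≤ 1` curve in
class `C`" assembled STRICTLY from published theorems — so that the rank-`≤ 1` remainder becomes
exactly the CONSTRUCTION-SHAPED classes, which are TYPED (missing-input `Prop`s), NOT attempted.
This is not "finishing BSD". Theorems only; NO definition, NO named fact; class X10b keeps its label
CONSTRUCTION-SHAPED (NEEDS X_A3, referee R82.3 / RESIDUAL-MAP §I N2); nothing is booked by this file;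
everything is PER PAIR; no census number moves.

## What (x10 GEN 25, X10-AUDIT §31)

x10 GEN 24's sibling file `X10/UnitRoadPartnerRecordsB.lean` recorded, for the same cells, X_A3 AT THE
PAIR (`MazurMainConjecture W 3`) by the TRIVIAL-PARTNER road: the partner `A` (`338d1`, `6845b1`, `13225a1`
or `256d1`) is good ordinary NON-anomalous at `3` with TRIVIAL `3`-primary arithmetic, x9 gen 5's
`mazurMainConjecture_with_mu_zero_of_trivialArithmetic_odd` (Kato 2004 Thm. 17.4 (1) `hkato`, Greenberg
1999 Thm. 4.1 `hGr`, period unit `h5`/`h3`) gives Mazur's main conjecture for `A` trivially, and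
Greenberg–Vatsal 2000 Thm. (1.4) (`hGV`) transports it along the kernel Hesse certificate C1
(`torsionIso_p<A>_u<E>`, Fisher 2012). THIS file records the CONSEQUENCE `BSDp W 3` (Miller's `BSD(E,3)`):
* analytic rank `0` (`hr0`): `UnitRoad.bsdp_three_of_ainvs_of_trivialPartner_rankZero` = the road ∘
  `Rank1Residual.bsdp_of_mazurMainConjecture_of_analyticRank_eq_zero` (Greenberg LNM 1716 Thm. 4.1 via
  Castella–Grossi–Lee–Skinner's deduction; modularity `hmod`; Gross–Zagier–Kolyvagin `hGZK`) — NO descent,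
  NO `L`-value, NO Tamagawa datum OF THE TARGET is used: Greenberg's Euler characteristic carries
  `#Ш(E)[3^∞]` and `∏ c_ℓ(E)` together, although `9 ∣ ∏ c_ℓ(E)` on every target (a route independent of
  the lane's `3`-descent line for these cells);
* analytic rank `1` (`hr1`): `UnitRoad.bsdp_three_of_ainvs_of_trivialPartner_rankOne_of_schneider` = the road ∘
  `Rank1Residual.bsdp_of_mazurMainConjecture_of_analyticRank_eq_one_of_schneider_odd` (Perrin-Riou–Schneider
  leading terms `hS`, Perrin-Riou's `3`-adic Gross–Zagier `hPR`, Mazur–Tate `σ` `hMT`; MODULO the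
  per-curve Schneider certificate `hSch` of the canonical `3`-adic height, displayed not discharged).
The partner's Tamagawa binder `htamA` of GEN 24 is DISCHARGED here by the kernel Tate-algorithm
certificate `UnitRoad.not_three_dvd_tamagawaProduct_p<A>` (`∏ c_ℓ(A)` = `2 / 4 / 4 / 2`,
`X10/UnitRoadBSD.lean` §0). DISPLAYED binders left: PUBLISHED `hkato`, `hGr`, `h5`, `h3`, `hGV`, `hmod`,
`hGZK` (+ `hS`, `hPR`, `hMT` in rank one); CENSUS (Cremona `allbsd` row of the PARTNER) `hLA`, `hSelA`;
`hr0` / `hr1` (analytic rank of the target, Cremona); `hSch` (rank one). Data `HOME/b2b-bsdres-x10/g24/gen/`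
(unchanged) + `g25/gen/mkbsd.py`. Per pair; class statement untouched; nothing booked.

References: R. Greenberg, V. Vatsal, Invent. Math. 142 (2000) Thm. (1.4) [GreenbergVatsal2000]; K.
Kato, Astérisque 295 (2004) Thm. 17.4 (1) [Kato2004Asterisque]; R. Greenberg, LNM 1716 (1999) Thm. 4.1
[GreenbergLNM1716]; F. Castella, G. Grossi, J. Lee, C. Skinner, Invent. Math. 227 (2022) Thm. 5.1.4
[CastellaEtAl2021]; B. Perrin-Riou, Invent. Math. 89 (1987) §1.4 [PerrinRiou1987]; J. Balakrishnan,
J. S. Müller, W. Stein, Math. Comp. 85 (2016) Thm. 1.7 [BalakrishnanMullerStein2015]; B. Mazur, J. Tate,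
Duke Math. J. 62 (1991) [MazurTate1991]; T. Fisher, Proc. LMS 104 (2012) Thm. 13.2, §13 [Fisher2012Hessian];
R. L. Miller, LMS J. Comput. Math. 14 (2011) Def. 1.1 [Miller2011LMS]; J. H. Silverman, GTM 151 (1994)
IV.9.4 [Silverman1994]; J. E. Cremona, tables [Cremona2006].
-/

set_option autoImplicit false

noncomputable section

open scoped Classical MatrixGroups ModularForm

open CongruenceSubgroup WeierstrassCurve Literature.NumberTheory.EllipticCurves
  Literature.NumberTheory.EllipticCurves.ModularForms Literature.NumberTheory.EllipticCurves.Rank1Residual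
  Literature.NumberTheory.EllipticCurves.Rank1Residual.X11RankOneCertificates
  Summit.BirchSwinnertonDyer.BirchSwinnertonDyer.Rank1Residual.IntModel
  Summit.BirchSwinnertonDyer.BirchSwinnertonDyer.Rank1Residual.X11RankOne
  Summit.BirchSwinnertonDyer.BirchSwinnertonDyer.Theorems.Rank1ResidualX1Defs

namespace Summit.BirchSwinnertonDyer.Rank1Residual.X10.UnitRoad

/-! ### `343850cr1` (3Ns, N = 343850, r_an = 0, ∏ c_ℓ = 216) ← `13225a1` -/

/-- **`BSD(E,3)` AT THE PAIR `(343850cr1, 3)` by the TRIVIAL-PARTNER road: `BSDp W 3`** — analytic rank `0`, NO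
descent / `L`-value / Tamagawa datum of the target used. Target `343850cr1 = [1, 1, 1, -515874463, -3956097324219]` (`N = 343850 = 2 · 5^2 · 13 · 23^2`, census
image `3Ns`; Cremona `allbsd`: analytic rank `0` (`hr0`), `#E(ℚ)_tors = 1`, `∏ c_ℓ = 216` (`ord₃ = 3`), `#Ш_an = 1` — so the
recorded `BSD(E,3)` says `ord₃ (L(E,1)/Ω_E) = ord₃ (#Ш(E)·∏ c_ℓ / #E(ℚ)²_tors)`, `= 3` on Cremona's data; `#Ẽ(𝔽₃) = 5`,
`a₃ = -1`; Frobenius witness `ℓ = 7`, `#Ẽ(𝔽_{7}) = 5`); partner `A = 13225a1 = [0, -1, 1, -383, -7832]` (`N_A = 13225 = 5² · 23²`; Cremona: rank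
`0`, `#A(ℚ)_tors = 1`, `#Ш_an = 1`, `L/Ω = 4`; `∏ c_ℓ(A) = 4` IN THE KERNEL (`tamagawaProduct_p13225a1`); `#Ã(𝔽₃) = 2`:
good ordinary NON-anomalous); C1 = `torsionIso_p13225a1_u343850cr1` (x10 GEN 24, kernel Hesse certificate). Displayed binders:
PUBLISHED `hkato`, `hGr`, `h5`, `h3`, `hGV`, `hmod`, `hGZK`; census `hLA`, `hSelA` (the PARTNER's row), `hr0`.
Per pair; class statement untouched; nothing booked. [cite: GreenbergVatsal2000, Thm. (1.4) (arXiv p. 5)]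
[cite: Kato2004Asterisque, Thm. 17.4 (1) (p. 273)] [cite: GreenbergLNM1716, Thm. 4.1 (p. 102)]
[cite: CastellaEtAl2021, Thm. 5.1.4 (proof, §5.1.3)] [cite: Miller2011LMS, Def. 1.1]
[cite: Fisher2012Hessian, Thm. 13.2 and §13] [cite: Cremona2006, Table 1 (Cremona labels 343850cr1, 13225a1)] -/
theorem bsdp_partner_u343850cr1
    (hkato : ∀ (W : WeierstrassCurve ℚ) [W.IsElliptic] [W.IsGloballyMinimal] (p : ℕ) [Fact p.Prime]
      (κ : ZpExtension ℚ p) (γ : Field.absoluteGaloisGroup ℚ) (N : ℕ) [NeZero N]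
      (f : CuspForm (Gamma0 N) 2), kato_divisibility W p (κ := κ) (γ := γ) (f := f))
    (hGr : greenberg_charValue_rankZero) (h5 : realPeriodRat_eq_unit_mul_plusPeriod)
    (h3 : realPeriodRat_eq_unit_mul_plusPeriod_three)
    (hGV : GreenbergVatsal2000.thm14_mainConjecture_transfer_of_torsionIso)
    (hmod : nonempty_modularParametrizationData)
    (hGZK : rank_eq_analyticRank_of_analyticRank_le_one)
    (W A : WeierstrassCurve ℚ) [W.IsElliptic] [W.IsGloballyMinimal] [A.IsElliptic] [A.IsGloballyMinimal]
    [Fact (Nat.Prime 3)]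
    (hW : W = ⟨1, 1, 1, (-515874463), (-3956097324219)⟩) (hA : A = ⟨0, (-1), 1, (-383), (-7832)⟩)
    (hLA : ∃ q : ℚ, q ≠ 0 ∧ A.entireLFunction 1 / (A.realPeriodRat : ℂ) = (q : ℂ) ∧ padicValRat 3 q = 0)
    (hSelA : Nat.card (A.selmerGroupPInfty 3) = 1)
    (hr0 : W.analyticRank = 0) :
    BSDp W 3 := by
  have hIW : integralModelInt W = ⟨1, 1, 1, (-515874463), (-3956097324219)⟩ :=
    integralModelInt_eq_of_map_eq _ (by rw [hW]; ext <;> simp [WeierstrassCurve.map])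
  have hIA : integralModelInt A = ⟨0, (-1), 1, (-383), (-7832)⟩ :=
    integralModelInt_eq_of_map_eq _ (by rw [hA]; ext <;> simp [WeierstrassCurve.map])
  haveI : Fact (Nat.Prime 7) := ⟨by norm_num⟩
  exact bsdp_three_of_ainvs_of_trivialPartner_rankZero hkato hGr h5 h3 hGV hmod hGZK
    1 1 1 (-515874463) (-3956097324219) hIW 0 (-1) 1 (-383) (-7832) hIA 7 5 5 2
    (by decide +kernel) card_u343850cr1_3 (by decide) (by decide) (by decide +kernel) card_u343850cr1_7
    (by decide +kernel) (by decide +kernel) card_p13225a1_3 (by decide) (by decide)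
    (not_three_dvd_tamagawaProduct_p13225a1 hIA) hLA hSelA (torsionIso_p13225a1_u343850cr1 W A hW hA) hr0

/-! ### `38870bf1` (3Ns, N = 38870, r_an = 0, ∏ c_ℓ = 36) ← `338d1` -/

/-- **`BSD(E,3)` AT THE PAIR `(38870bf1, 3)` by the TRIVIAL-PARTNER road: `BSDp W 3`** — analytic rank `0`, NO
descent / `L`-value / Tamagawa datum of the target used. Target `38870bf1 = [1, 1, 1, -7630776, 5334716473]` (`N = 38870 = 2 · 5 · 13^2 · 23`, census
image `3Ns`; Cremona `allbsd`: analytic rank `0` (`hr0`), `#E(ℚ)_tors = 1`, `∏ c_ℓ = 36` (`ord₃ = 2`), `#Ш_an = 1` — so the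
recorded `BSD(E,3)` says `ord₃ (L(E,1)/Ω_E) = ord₃ (#Ш(E)·∏ c_ℓ / #E(ℚ)²_tors)`, `= 2` on Cremona's data; `#Ẽ(𝔽₃) = 5`,
`a₃ = -1`; Frobenius witness `ℓ = 7`, `#Ẽ(𝔽_{7}) = 5`); partner `A = 338d1 = [1, 1, 0, 504, -13112]` (`N_A = 338 = 2 · 13²`; Cremona: rank
`0`, `#A(ℚ)_tors = 1`, `#Ш_an = 1`, `L/Ω = 2`; `∏ c_ℓ(A) = 2` IN THE KERNEL (`tamagawaProduct_p338d1`); `#Ã(𝔽₃) = 5`: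
good ordinary NON-anomalous); C1 = `torsionIso_p338d1_u38870bf1` (x10 GEN 24, kernel Hesse certificate). Displayed binders:
PUBLISHED `hkato`, `hGr`, `h5`, `h3`, `hGV`, `hmod`, `hGZK`; census `hLA`, `hSelA` (the PARTNER's row), `hr0`.
Per pair; class statement untouched; nothing booked. [cite: GreenbergVatsal2000, Thm. (1.4) (arXiv p. 5)]
[cite: Kato2004Asterisque, Thm. 17.4 (1) (p. 273)] [cite: GreenbergLNM1716, Thm. 4.1 (p. 102)]
[cite: CastellaEtAl2021, Thm. 5.1.4 (proof, §5.1.3)] [cite: Miller2011LMS, Def. 1.1]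
[cite: Fisher2012Hessian, Thm. 13.2 and §13] [cite: Cremona2006, Table 1 (Cremona labels 38870bf1, 338d1)] -/
theorem bsdp_partner_u38870bf1
    (hkato : ∀ (W : WeierstrassCurve ℚ) [W.IsElliptic] [W.IsGloballyMinimal] (p : ℕ) [Fact p.Prime]
      (κ : ZpExtension ℚ p) (γ : Field.absoluteGaloisGroup ℚ) (N : ℕ) [NeZero N]
      (f : CuspForm (Gamma0 N) 2), kato_divisibility W p (κ := κ) (γ := γ) (f := f))
    (hGr : greenberg_charValue_rankZero) (h5 : realPeriodRat_eq_unit_mul_plusPeriod)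
    (h3 : realPeriodRat_eq_unit_mul_plusPeriod_three)
    (hGV : GreenbergVatsal2000.thm14_mainConjecture_transfer_of_torsionIso)
    (hmod : nonempty_modularParametrizationData)
    (hGZK : rank_eq_analyticRank_of_analyticRank_le_one)
    (W A : WeierstrassCurve ℚ) [W.IsElliptic] [W.IsGloballyMinimal] [A.IsElliptic] [A.IsGloballyMinimal]
    [Fact (Nat.Prime 3)]
    (hW : W = ⟨1, 1, 1, (-7630776), 5334716473⟩) (hA : A = ⟨1, 1, 0, 504, (-13112)⟩)
    (hLA : ∃ q : ℚ, q ≠ 0 ∧ A.entireLFunction 1 / (A.realPeriodRat : ℂ) = (q : ℂ) ∧ padicValRat 3 q = 0)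
    (hSelA : Nat.card (A.selmerGroupPInfty 3) = 1)
    (hr0 : W.analyticRank = 0) :
    BSDp W 3 := by
  have hIW : integralModelInt W = ⟨1, 1, 1, (-7630776), 5334716473⟩ :=
    integralModelInt_eq_of_map_eq _ (by rw [hW]; ext <;> simp [WeierstrassCurve.map])
  have hIA : integralModelInt A = ⟨1, 1, 0, 504, (-13112)⟩ :=
    integralModelInt_eq_of_map_eq _ (by rw [hA]; ext <;> simp [WeierstrassCurve.map])
  haveI : Fact (Nat.Prime 7) := ⟨by norm_num⟩
  exact bsdp_three_of_ainvs_of_trivialPartner_rankZero hkato hGr h5 h3 hGV hmod hGZK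
    1 1 1 (-7630776) 5334716473 hIW 1 1 0 504 (-13112) hIA 7 5 5 5
    (by decide +kernel) card_u38870bf1_3 (by decide) (by decide) (by decide +kernel) card_u38870bf1_7
    (by decide +kernel) (by decide +kernel) card_p338d1_3 (by decide) (by decide)
    (not_three_dvd_tamagawaProduct_p338d1 hIA) hLA hSelA (torsionIso_p338d1_u38870bf1 W A hW hA) hr0

/-! ### `72670w1` (3Ns, N = 72670, r_an = 0, ∏ c_ℓ = 36) ← `338d1` -/

/-- **`BSD(E,3)` AT THE PAIR `(72670w1, 3)` by the TRIVIAL-PARTNER road: `BSDp W 3`** — analytic rank `0`, NO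
descent / `L`-value / Tamagawa datum of the target used. Target `72670w1 = [1, 1, 1, -34087050, -76614917033]` (`N = 72670 = 2 · 5 · 13^2 · 43`, census
image `3Ns`; Cremona `allbsd`: analytic rank `0` (`hr0`), `#E(ℚ)_tors = 1`, `∏ c_ℓ = 36` (`ord₃ = 2`), `#Ш_an = 1` — so the
recorded `BSD(E,3)` says `ord₃ (L(E,1)/Ω_E) = ord₃ (#Ш(E)·∏ c_ℓ / #E(ℚ)²_tors)`, `= 2` on Cremona's data; `#Ẽ(𝔽₃) = 5`,
`a₃ = -1`; Frobenius witness `ℓ = 7`, `#Ẽ(𝔽_{7}) = 8`); partner `A = 338d1 = [1, 1, 0, 504, -13112]` (`N_A = 338 = 2 · 13²`; Cremona: rank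
`0`, `#A(ℚ)_tors = 1`, `#Ш_an = 1`, `L/Ω = 2`; `∏ c_ℓ(A) = 2` IN THE KERNEL (`tamagawaProduct_p338d1`); `#Ã(𝔽₃) = 5`:
good ordinary NON-anomalous); C1 = `torsionIso_p338d1_u72670w1` (x10 GEN 24, kernel Hesse certificate). Displayed binders:
PUBLISHED `hkato`, `hGr`, `h5`, `h3`, `hGV`, `hmod`, `hGZK`; census `hLA`, `hSelA` (the PARTNER's row), `hr0`.
Per pair; class statement untouched; nothing booked. [cite: GreenbergVatsal2000, Thm. (1.4) (arXiv p. 5)]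
[cite: Kato2004Asterisque, Thm. 17.4 (1) (p. 273)] [cite: GreenbergLNM1716, Thm. 4.1 (p. 102)]
[cite: CastellaEtAl2021, Thm. 5.1.4 (proof, §5.1.3)] [cite: Miller2011LMS, Def. 1.1]
[cite: Fisher2012Hessian, Thm. 13.2 and §13] [cite: Cremona2006, Table 1 (Cremona labels 72670w1, 338d1)] -/
theorem bsdp_partner_u72670w1
    (hkato : ∀ (W : WeierstrassCurve ℚ) [W.IsElliptic] [W.IsGloballyMinimal] (p : ℕ) [Fact p.Prime]
      (κ : ZpExtension ℚ p) (γ : Field.absoluteGaloisGroup ℚ) (N : ℕ) [NeZero N]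
      (f : CuspForm (Gamma0 N) 2), kato_divisibility W p (κ := κ) (γ := γ) (f := f))
    (hGr : greenberg_charValue_rankZero) (h5 : realPeriodRat_eq_unit_mul_plusPeriod)
    (h3 : realPeriodRat_eq_unit_mul_plusPeriod_three)
    (hGV : GreenbergVatsal2000.thm14_mainConjecture_transfer_of_torsionIso)
    (hmod : nonempty_modularParametrizationData)
    (hGZK : rank_eq_analyticRank_of_analyticRank_le_one)
    (W A : WeierstrassCurve ℚ) [W.IsElliptic] [W.IsGloballyMinimal] [A.IsElliptic] [A.IsGloballyMinimal]
    [Fact (Nat.Prime 3)]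
    (hW : W = ⟨1, 1, 1, (-34087050), (-76614917033)⟩) (hA : A = ⟨1, 1, 0, 504, (-13112)⟩)
    (hLA : ∃ q : ℚ, q ≠ 0 ∧ A.entireLFunction 1 / (A.realPeriodRat : ℂ) = (q : ℂ) ∧ padicValRat 3 q = 0)
    (hSelA : Nat.card (A.selmerGroupPInfty 3) = 1)
    (hr0 : W.analyticRank = 0) :
    BSDp W 3 := by
  have hIW : integralModelInt W = ⟨1, 1, 1, (-34087050), (-76614917033)⟩ :=
    integralModelInt_eq_of_map_eq _ (by rw [hW]; ext <;> simp [WeierstrassCurve.map])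
  have hIA : integralModelInt A = ⟨1, 1, 0, 504, (-13112)⟩ :=
    integralModelInt_eq_of_map_eq _ (by rw [hA]; ext <;> simp [WeierstrassCurve.map])
  haveI : Fact (Nat.Prime 7) := ⟨by norm_num⟩
  exact bsdp_three_of_ainvs_of_trivialPartner_rankZero hkato hGr h5 h3 hGV hmod hGZK
    1 1 1 (-34087050) (-76614917033) hIW 1 1 0 504 (-13112) hIA 7 8 5 5
    (by decide +kernel) card_u72670w1_3 (by decide) (by decide) (by decide +kernel) card_u72670w1_7
    (by decide +kernel) (by decide +kernel) card_p338d1_3 (by decide) (by decide)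
    (not_three_dvd_tamagawaProduct_p338d1 hIA) hLA hSelA (torsionIso_p338d1_u72670w1 W A hW hA) hr0

/-! ### `107822s1` (3Ns, N = 107822, r_an = 1, ∏ c_ℓ = 108) ← `338d1` -/

/-- **`BSD(E,3)` AT THE PAIR `(107822s1, 3)` — an N2 cell of ANALYTIC RANK ONE — by the TRIVIAL-PARTNER road,
MODULO the Schneider certificate: `BSDp W 3`.** Target `107822s1 = [1, 1, 1, 3552, -61183]` (`N = 107822 = 2 · 11 · 13^2 · 29`, census image
`3Ns`; Cremona `allbsd`: analytic rank `1` (`hr1`), `#E(ℚ)_tors = 1`, `∏ c_ℓ = 108` (`ord₃ = 3`), `#Ш_an = 1` — so the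
recorded `BSD(E,3)` says `ord₃ (L'(E,1)/(Ω_E·Reg_E)) = ord₃ (#Ш(E)·∏ c_ℓ / #E(ℚ)²_tors)`, `= 3` on Cremona's data;
`#Ẽ(𝔽₃) = 2`, `a₃ = 2`; Frobenius witness `ℓ = 7`, `#Ẽ(𝔽_{7}) = 5`); partner `A = 338d1 = [1, 1, 0, 504, -13112]`
(`N_A = 338 = 2 · 13²`; Cremona: rank `0`, `#A(ℚ)_tors = 1`, `#Ш_an = 1`, `L/Ω = 2`; `∏ c_ℓ(A) = 2` IN THE KERNEL
(`tamagawaProduct_p338d1`); `#Ã(𝔽₃) = 5`: good ordinary NON-anomalous); C1 = `torsionIso_p338d1_u107822s1` (x10 GEN 24, kernel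
Hesse certificate). Displayed binders: PUBLISHED `hkato`, `hGr`, `h5`, `h3`, `hGV`, `hS`, `hPR`, `hMT`, `hmod`,
`hGZK`; census `hLA`, `hSelA` (the PARTNER's row), `hr1`; the CERTIFICATE `hSch` (non-degeneracy of the
canonical cyclotomic `3`-adic height of `E` — a `3`-adic computation per curve, NOT supplied here). Per pair;
class statement untouched; nothing booked. [cite: GreenbergVatsal2000, Thm. (1.4) (arXiv p. 5)]
[cite: Kato2004Asterisque, Thm. 17.4 (1) (p. 273)] [cite: PerrinRiou1987, §1.4 Cor. 1.8]
[cite: BalakrishnanMullerStein2015, Thm. 1.7] [cite: MazurTate1991, Thm. 3.1] [cite: Miller2011LMS, Def. 1.1]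
[cite: Fisher2012Hessian, Thm. 13.2 and §13] [cite: Cremona2006, Table 1 (Cremona labels 107822s1, 338d1)] -/
theorem bsdp_partner_u107822s1
    (hkato : ∀ (W : WeierstrassCurve ℚ) [W.IsElliptic] [W.IsGloballyMinimal] (p : ℕ) [Fact p.Prime]
      (κ : ZpExtension ℚ p) (γ : Field.absoluteGaloisGroup ℚ) (N : ℕ) [NeZero N]
      (f : CuspForm (Gamma0 N) 2), kato_divisibility W p (κ := κ) (γ := γ) (f := f))
    (hGr : greenberg_charValue_rankZero) (h5 : realPeriodRat_eq_unit_mul_plusPeriod)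
    (h3 : realPeriodRat_eq_unit_mul_plusPeriod_three)
    (hGV : GreenbergVatsal2000.thm14_mainConjecture_transfer_of_torsionIso)
    (hS : Schneider1985_order_charGenerator_odd) (hPR : perrinRiou_rankOne_leadingTerms_odd)
    (hMT : mazur_tate_sigma_exists_odd)
    (hmod : nonempty_modularParametrizationData)
    (hGZK : rank_eq_analyticRank_of_analyticRank_le_one)
    (W A : WeierstrassCurve ℚ) [W.IsElliptic] [W.IsGloballyMinimal] [A.IsElliptic] [A.IsGloballyMinimal]
    [Fact (Nat.Prime 3)]
    (hW : W = ⟨1, 1, 1, 3552, (-61183)⟩) (hA : A = ⟨1, 1, 0, 504, (-13112)⟩)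
    (hLA : ∃ q : ℚ, q ≠ 0 ∧ A.entireLFunction 1 / (A.realPeriodRat : ℂ) = (q : ℂ) ∧ padicValRat 3 q = 0)
    (hSelA : Nat.card (A.selmerGroupPInfty 3) = 1)
    (hr1 : W.analyticRank = 1)
    (hSch : ∀ Dh : PAdicHeightData W 3, Dh.IsCanonical → SchneiderConjecture Dh) :
    BSDp W 3 := by
  have hIW : integralModelInt W = ⟨1, 1, 1, 3552, (-61183)⟩ :=
    integralModelInt_eq_of_map_eq _ (by rw [hW]; ext <;> simp [WeierstrassCurve.map])
  have hIA : integralModelInt A = ⟨1, 1, 0, 504, (-13112)⟩ :=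
    integralModelInt_eq_of_map_eq _ (by rw [hA]; ext <;> simp [WeierstrassCurve.map])
  haveI : Fact (Nat.Prime 7) := ⟨by norm_num⟩
  exact bsdp_three_of_ainvs_of_trivialPartner_rankOne_of_schneider hkato hGr h5 h3 hGV hS hPR hMT hmod hGZK
    1 1 1 3552 (-61183) hIW 1 1 0 504 (-13112) hIA 7 5 2 5
    (by decide +kernel) card_u107822s1_3 (by decide) (by decide) (by decide +kernel) card_u107822s1_7
    (by decide +kernel) (by decide +kernel) card_p338d1_3 (by decide) (by decide)
    (not_three_dvd_tamagawaProduct_p338d1 hIA) hLA hSelA (torsionIso_p338d1_u107822s1 W A hW hA) hr1 hSch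

end Summit.BirchSwinnertonDyer.Rank1Residual.X10.UnitRoad

end
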